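import Summits.ResolutionOfSingularities.ResolutionOfSingularities.Theorems.FrobeniusLadderFInjectiveMacaulayficationIntrinsicTower
import Summits.ResolutionOfSingularities.ResolutionOfSingularities.Theorems.FrobeniusLadderFInjectiveMacaulayficationTauCentreBlowupFull
import Literature.AlgebraicGeometry.Resolution.IdealSheafLemmas
import HarnessLib

/-!
# THE FIRST KERNEL INSTANCE OF THE INTRINSIC TOWER: `TowerFull 2 1 (Spec C′)` — floor 1 of the τ-tower of P2d4C, principal chart, is FULL after EXACTLY ONE
# intrinsic floor (crux `FInjectiveMacaulayfication` stmt-ResolutionOfSingularities-15315, chain w45a; res-L1-w45a-plan-1 g19 RULING R19.5 (4) GO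
# «first `TowerFull n` statement in the kernel»; over (TT-K) p631540 `…IntrinsicTower` and res-L1-w45a-stub-2 g7's p617159 `…TauCentreBlowupFull`; seat res-L1-w45a-stub-2 g8)

[OURS · L1 W4.5a] Support file (`--supports stmt-ResolutionOfSingularities-15315 --as helper`); def-free, unconditional; replaces the role of NO printed item;
NOT a statement of the manuscript; AI-written (AI review is weaker than expert review).

`C′ = k[x,y,u,t,z′]/(F′)`, `F′ = z′² + x²z′ + x²(y³+u³+t³)` (`X 0 = x`, `X 4 = z′`), `char k = 2` — the `D(x̄²)` chart of the τ-floor `S′ = Bl_τ X` of P2d4C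
(`TauFloorOneXChartIdent`, p622342), whose non-FULL locus is EXACTLY `V(x̄, z̄′)` (3-dimensional) and whose blowing up along `𝒦 := (x̄, z̄′)~` is FULL at every
point (`TauCentreBlowupFull.tauCentre_fHalfShape`, p617159). In the language of the «TT» programme (`IntrinsicTower`, p631540):
* `centre_eq_idealSheaf_XZ` — the INTRINSIC centre (reduced ideal sheaf of the closure of the non-FULL locus) of `Spec C′` IS `𝒦` (the locus is already closed and
  equal to `supp 𝒦`; `vanishingIdeal (supp 𝒦) = 𝒦.radical` (Mathlib) `= 𝒦` because `(x̄, z̄′)` is prime, `TauFloorOneNotFull.primeXZ_isPrime`);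
* ★ `towerFull_one` — `IntrinsicTower.TowerFull 2 1 (Spec C′)`: every blowing up along the intrinsic centre is FULL at every point;
* `not_towerFull_zero` — `¬ TowerFull 2 0 (Spec C′)` (the chart is not FULL: the generic point of `V(x̄, z̄′)` is a non-FULL point, p615290);
* `towerHeight_eq_one` — the conjunction: the intrinsic tower of `Spec C′` has height EXACTLY one.
HONEST LABEL (R19.5 (4)): a POSITIVE ONE-FLOOR instance of the N-recipe (`IntrinsicTower.centre` = reduced non-FULL locus) at a τ-floor chart — the recipe's
CONTESTED regime is point floors (res-L1-w45a-idea-1 FB5-r5 §3.2), so the evidence weight is modest; the plumbing value is the first `TowerFull n` statement in the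
kernel. The `tauCentre` (rad-τ) twin of this instance would need a kernel identification `rad τ(C′) = (x̄, z̄′)` (a test-ideal computation not in the tree) —
deferred (idea-1 (B4″)). [folklore assembly; cite: Fedder1983, Thm. 1.12; GortzWedhorn2020, Prop. 13.92; StacksProject, Tag 0804]
-/

-- single-problem summit: the doubled namespace component is forced
set_option linter.dupNamespace false

noncomputable section

open AlgebraicGeometry CategoryTheory Literature.AlgebraicGeometry.Resolution TopologicalSpace IsLocalRing MvPolynomial

namespace Summit.ResolutionOfSingularities.ResolutionOfSingularities.Theorems.FInjectiveMacaulayfication.IntrinsicTower.InstanceTauFloorP2d4C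

open Summit.ResolutionOfSingularities.ResolutionOfSingularities.Theorems.FInjectiveMacaulayfication
open SliceableCentre IntrinsicTower

/-! ## §1 The intrinsic centre of the chart is `(x̄, z̄′)~` -/

/-- On an affine scheme, the radical of the ideal sheaf of a PRIME ideal is itself. [folklore] -/
theorem radical_idealSheaf_of_isPrime {R : Type} [CommRing R] (P : Ideal R) [hP : P.IsPrime] :
    (affineBlowup.idealSheaf P).radical = affineBlowup.idealSheaf P := by
  apply Scheme.IdealSheafData.ext_of_isAffine
  rw [Scheme.IdealSheafData.radical_ideal, affineBlowup.idealSheaf, ideal_ofIdealTop_top]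
  -- `P · Γ(Spec R, ⊤)` is prime: the map is an isomorphism
  let e : R ≃+* Γ(Spec (.of R), ⊤) := (Scheme.ΓSpecIso (.of R)).symm.commRingCatIsoToRingEquiv
  have he : (Scheme.ΓSpecIso (.of R)).inv.hom = (e : R →+* Γ(Spec (.of R), ⊤)) := rfl
  rw [he, Ideal.map_comap_of_equiv]
  exact (Ideal.comap_isPrime e.symm P).radical

/-- ★ **The INTRINSIC centre of `Spec C′` is `(x̄, z̄′)~`**: the non-FULL locus is closed and equals `supp (x̄, z̄′)~` (p617159), whose vanishing ideal sheaf is the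
radical of `(x̄, z̄′)~` (Mathlib `vanishingIdeal_support`), i.e. `(x̄, z̄′)~` itself (`(x̄, z̄′)` is prime). [folklore assembly] -/
theorem centre_eq_idealSheaf_XZ (k : Type) [Field k] [CharP k 2] (F' : MvPolynomial (Fin 5) k)
    (hF : F' = X 4 ^ 2 + X 0 ^ 2 * X 4 + X 0 ^ 2 * (X 1 ^ 3 + X 2 ^ 3 + X 3 ^ 3)) :
    IntrinsicTower.centre 2 (Spec (.of (MvPolynomial (Fin 5) k ⧸ Ideal.span {F'}))) =
      affineBlowup.idealSheaf (Ideal.span ({Ideal.Quotient.mk (Ideal.span {F'}) (X 0), Ideal.Quotient.mk (Ideal.span {F'}) (X 4)} :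
        Set (MvPolynomial (Fin 5) k ⧸ Ideal.span {F'}))) := by
  haveI := TauFloorOneNotFull.primeXZ_isPrime k F' hF
  obtain ⟨-, hsupp, -⟩ := TauCentreBlowupFull.tauCentre_fHalfShape k F' hF
  -- the non-FULL locus IS the support of `(x̄, z̄′)~`, a closed set
  have hlocus : nonFullLocus 2 (Spec (.of (MvPolynomial (Fin 5) k ⧸ Ideal.span {F'}))) =
      ((affineBlowup.idealSheaf (Ideal.span ({Ideal.Quotient.mk (Ideal.span {F'}) (X 0), Ideal.Quotient.mk (Ideal.span {F'}) (X 4)} :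
        Set (MvPolynomial (Fin 5) k ⧸ Ideal.span {F'})))).support : Set (Spec (.of (MvPolynomial (Fin 5) k ⧸ Ideal.span {F'})))) :=
    Set.ext fun w => (hsupp w).symm
  have hcl : (⟨closure (nonFullLocus 2 (Spec (.of (MvPolynomial (Fin 5) k ⧸ Ideal.span {F'})))), isClosed_closure⟩ :
      Closeds (Spec (.of (MvPolynomial (Fin 5) k ⧸ Ideal.span {F'})))) =
      (affineBlowup.idealSheaf (Ideal.span ({Ideal.Quotient.mk (Ideal.span {F'}) (X 0), Ideal.Quotient.mk (Ideal.span {F'}) (X 4)} :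
        Set (MvPolynomial (Fin 5) k ⧸ Ideal.span {F'})))).support := by
    apply Closeds.ext
    change closure _ = _
    rw [hlocus]
    exact (Scheme.IdealSheafData.support _).isClosed.closure_eq
  rw [IntrinsicTower.centre, hcl, Scheme.IdealSheafData.vanishingIdeal_support, radical_idealSheaf_of_isPrime]

/-! ## §2 ★ `TowerFull 2 1 (Spec C′)`, and the tower has height exactly one -/

/-- ★ **`TowerFull 2 1 (Spec C′)`**: EVERY blowing up of the principal τ-floor chart of P2d4C along its INTRINSIC centre is FULL at every point (§1 + p617159's
«every blowing up along `(x̄, z̄′)~` is FULL»). The first `TowerFull n` statement in the kernel. [OURS · certificate; cite: Fedder1983, Thm. 1.12;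
GortzWedhorn2020, Prop. 13.92] -/
theorem towerFull_one (k : Type) [Field k] [CharP k 2] (F' : MvPolynomial (Fin 5) k)
    (hF : F' = X 4 ^ 2 + X 0 ^ 2 * X 4 + X 0 ^ 2 * (X 1 ^ 3 + X 2 ^ 3 + X 3 ^ 3)) :
    IntrinsicTower.TowerFull 2 1 (Spec (.of (MvPolynomial (Fin 5) k ⧸ Ideal.span {F'}))) := by
  rw [towerFull_succ]
  intro S₁ g hg
  rw [centre_eq_idealSheaf_XZ k F' hF] at hg
  exact (TauCentreBlowupFull.tauCentre_fHalfShape k F' hF).2.2 S₁ g hg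

/-- **`¬ TowerFull 2 0 (Spec C′)`**: the chart itself is NOT FULL — the generic point of `V(x̄, z̄′)` is a non-FULL point (`TauFloorOneNotFull`, p615290).
[OURS · certificate; cite: Fedder1983, Prop. 1.7] -/
theorem not_towerFull_zero (k : Type) [Field k] [CharP k 2] (F' : MvPolynomial (Fin 5) k)
    (hF : F' = X 4 ^ 2 + X 0 ^ 2 * X 4 + X 0 ^ 2 * (X 1 ^ 3 + X 2 ^ 3 + X 3 ^ 3)) :
    ¬ IntrinsicTower.TowerFull 2 0 (Spec (.of (MvPolynomial (Fin 5) k ⧸ Ideal.span {F'}))) := by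
  rw [towerFull_zero]
  intro h
  haveI := TauFloorOneNotFull.primeXZ_isPrime k F' hF
  let w : Spec (.of (MvPolynomial (Fin 5) k ⧸ Ideal.span {F'})) :=
    ⟨Ideal.span ({Ideal.Quotient.mk (Ideal.span {F'}) (X 0), Ideal.Quotient.mk (Ideal.span {F'}) (X 4)} :
      Set (MvPolynomial (Fin 5) k ⧸ Ideal.span {F'})), inferInstance⟩
  exact TauFloorOneNotFull.not_fullCl_stalk_of_mem_VXZ k F' hF w (Ideal.subset_span (Or.inl rfl)) (Ideal.subset_span (Or.inr rfl)) (h w)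

/-- **THE INTRINSIC TOWER OF `Spec C′` HAS HEIGHT EXACTLY ONE** (`¬ TowerFull 2 0 ∧ TowerFull 2 1`). HONEST LABEL: a positive one-floor instance of the N-recipe at
a τ-floor chart (the recipe's contested regime is point floors, res-L1-w45a-idea-1 FB5-r5); evidence weight modest, plumbing value real. [OURS · certificate] -/
theorem towerHeight_eq_one (k : Type) [Field k] [CharP k 2] (F' : MvPolynomial (Fin 5) k)
    (hF : F' = X 4 ^ 2 + X 0 ^ 2 * X 4 + X 0 ^ 2 * (X 1 ^ 3 + X 2 ^ 3 + X 3 ^ 3)) :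
    ¬ IntrinsicTower.TowerFull 2 0 (Spec (.of (MvPolynomial (Fin 5) k ⧸ Ideal.span {F'}))) ∧
      IntrinsicTower.TowerFull 2 1 (Spec (.of (MvPolynomial (Fin 5) k ⧸ Ideal.span {F'}))) :=
  ⟨not_towerFull_zero k F' hF, towerFull_one k F' hF⟩

end Summit.ResolutionOfSingularities.ResolutionOfSingularities.Theorems.FInjectiveMacaulayfication.IntrinsicTower.InstanceTauFloorP2d4C

end
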